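import Summits.AtomisticToContinuum.Crystallization.Theorems.ThreeConeCertificateSlackRigidityPricedFloorsRootCake
import Summits.AtomisticToContinuum.Crystallization.Theorems.ThreeConeCertificateSlackRigidityPricedFloorsS3Defs2
import HarnessLib

/-!
# `SlackRigidity` (stmt-AtomisticToContinuum-11960), line `priced-floors-palm-exactification`, stub S3
# (`stub_layeredMeanSelection`): final assembly, part 0 — almost every sample is a fitted hard-core set

Lead c19.  Under a law carried by rooted `δ`-hard-core configurations that are almost surely globally
exactly layered, almost every sample is `count|S` for a rooted `δ`-separated `S` fitted by normal-form
layering data (`lms_ae_fitted`, registered); plus the uniform layer-weight vector of the transport over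
the `2n+1` layers around the root (`lms_uniformCoeff_props`).  All `[folklore]`.
-/

noncomputable section

open MeasureTheory Filter Set
open scoped ENNReal BigOperators

namespace Summit.AtomisticToContinuum.Crystallization.Theorems.SlackRigidityPricedFloorsFinal

open Literature.Probability.Process
open Literature.MathematicalPhysics.StatisticalMechanics
open Summit.AtomisticToContinuum.Crystallization.Theorems.SlackRigidityPricedFloors
open Summit.AtomisticToContinuum.Crystallization.Theorems.SlackRigidityPricedFloorsRootCake

/-- A rooted, globally layered set is fitted by normal-form data. [folklore] -/
theorem exists_fits_of_globalLayered {S : Set E3} (hS : GlobalLayered S) (h0 : (0 : E3) ∈ S) :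
    ∃ e : LData, Fits S e := by
  obtain ⟨A, a, s, z, hadm, hz0, rfl⟩ := exists_normalForm hS h0
  exact ⟨_, fits_layeredSet hadm hz0⟩

/-- **Almost every sample is a fitted hard-core set** (registered sub-goal `lms_ae_fitted`). [folklore] -/
theorem lms_ae_fitted : ∀ (δ : ℝ) (P : Measure (Measure E3)), (∀ᵐ μ ∂P, IsRootedHardCore δ μ) → (∀ᵐ μ ∂P, GlobalLayered (atoms μ)) → ∀ᵐ μ ∂P, ∃ (S : Set E3) (e : LData), (0 : E3) ∈ S ∧ (∀ x ∈ S, ∀ y ∈ S, x ≠ y → δ ≤ dist x y) ∧ Fits S e ∧ μ = (Measure.count : Measure E3).restrict S := by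
  intro δ P hcore hGL
  filter_upwards [hcore, hGL] with μ hc hG
  obtain ⟨S, h0, hsep, rfl⟩ := hc
  rw [atoms_count_restrict] at hG
  obtain ⟨e, he⟩ := exists_fits_of_globalLayered hG h0
  exact ⟨S, e, h0, hsep, he, rfl⟩

/-- **The uniform layer-weight vector** `c m = 1/(2n+1)` on `|m| ≤ n`, `0` outside: nonnegative,
symmetric, supported in `|m| ≤ n`, total mass `1`, and its weighted indicator sum is the averaged one.
[folklore] -/
theorem lms_uniformCoeff_props (n : ℕ) :
    (∀ m : ℤ, 0 ≤ (if m ∈ Finset.Icc (-(n : ℤ)) n then (1 : ℝ) / (2 * n + 1) else 0)) ∧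
    (∀ m : ℤ, (if -m ∈ Finset.Icc (-(n : ℤ)) n then (1 : ℝ) / (2 * n + 1) else 0) =
      (if m ∈ Finset.Icc (-(n : ℤ)) n then (1 : ℝ) / (2 * n + 1) else 0)) ∧
    (∀ m : ℤ, (n : ℤ) < |m| → (if m ∈ Finset.Icc (-(n : ℤ)) n then (1 : ℝ) / (2 * n + 1) else 0) = 0) ∧
    (∑ m ∈ Finset.Icc (-(n : ℤ)) n, (if m ∈ Finset.Icc (-(n : ℤ)) n then (1 : ℝ) / (2 * n + 1) else 0) = 1) ∧
    (∀ f : ℤ → ℝ, ∑ m ∈ Finset.Icc (-(n : ℤ)) n,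
        (if m ∈ Finset.Icc (-(n : ℤ)) n then (1 : ℝ) / (2 * n + 1) else 0) * f m =
      (1 / (2 * (n : ℝ) + 1)) * ∑ m ∈ Finset.Icc (-(n : ℤ)) n, f m) := by
  have hpos : (0 : ℝ) < 2 * n + 1 := by positivity
  refine ⟨fun m => by split_ifs <;> positivity, fun m => ?_, fun m hm => ?_, ?_, fun f => ?_⟩
  · congr 1
    simp only [Finset.mem_Icc, eq_iff_iff]
    omega
  · rw [if_neg]
    simp only [Finset.mem_Icc, not_and_or, not_le]
    rcases le_or_gt 0 m with h | h
    · rw [abs_of_nonneg h] at hm; exact Or.inr hm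
    · rw [abs_of_neg h] at hm; exact Or.inl (by omega)
  · rw [Finset.sum_ite_of_true (fun m hm => hm), Finset.sum_const, nsmul_eq_mul, Int.card_Icc]
    have : ((n : ℤ) + 1 - -(n : ℤ)).toNat = 2 * n + 1 := by omega
    rw [this]
    push_cast
    field_simp
  · rw [Finset.mul_sum]
    refine Finset.sum_congr rfl fun m hm => ?_
    rw [if_pos hm]

end Summit.AtomisticToContinuum.Crystallization.Theorems.SlackRigidityPricedFloorsFinal

end
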